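import Mathlib.Topology.Instances.ZMod
import Mathlib.Topology.Algebra.Group.Basic
import Mathlib.Data.ZMod.Basic
import Literature.IUT.HodgeTheaters.PuncturedEllipticCoveringsCharacteristic
import HarnessLib

/-!
# A finite model of `PuncturedEllipticData` satisfying the printed claims of [IUTchI] §1 — consistency witness

Mochizuki, *Inter-universal Teichmüller theory I*, kurims manuscript (May 2020), §1, pp. 37–40
([IUTchI] §1 pp.37-40) [claim: Mochizuki2012, status: disputed].  §1 is typed (seat abc-iut-L5-t1,
`PuncturedEllipticCoverings.lean`) as PREDICATES `ArrowCoveringClaims`, `Rmk121`,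
`CharacteristicNatureOfCoverings` on the data structure `PuncturedEllipticData` (over the tree's
`FundamentalExtension`); the companion `PuncturedEllipticCoveringsCharacteristic.lean` (abc-iut-L5-d4)
proves the group-theoretic core of Cor. 1.2 UNDER `ArrowCoveringClaims`/`Rmk121`.  This file exhibits
an INHABITANT `toyDatum` for which `ArrowCoveringClaims`, `Rmk121` AND the typed Corollary 1.2
`CharacteristicNatureOfCoverings toyDatum toyDatum` all HOLD (the last through the companion's
assembly theorem): the predicates are jointly satisfiable exactly as typed (relative-index and
normaliser conventions included), so no implication theorem over them is vacuous for want of a model.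
The model is DEGENERATE and finite, not the arithmetic situation of p. 37: `l = 5`, `Π_C = ℤ/10`
(discrete, multiplicative notation), `G_k = 1` (so `Δ_C = Π_C`), `Π_C̲ = Π_C`, `Π_X = Π_X̲ = 2ℤ/10`
(index `2`), cusps `ε⁰, ε′, ε″, 2ε` with decomposition groups `1, Π_X̲, Π_X̲, 1`; the construction of
pp. 37–38 collapses to `modLKer = deltaEpsKer = jKer = Π_{X→} = 1`, `galKer = Π_{C→} = 5ℤ/10`, and the
printed claims read `[Π_X̲ : 1] = 5 = l`, `[Π_C̲ : Π_{X→}] = 2l`, `[Π_C̲ : Π_{C→}] = l`,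
`Π_X̲ ∩ Π_{C→} = Π_{X→}`, cyclic quotients, `N(Π_{X→}) = N(Π_{C→}) = Π_C̲`.  Nothing here bears on the
curves of interest; record-only, no side taken on [IUTchIII] Cor. 3.12.
-/

namespace Literature.IUT.HodgeTheaters

namespace PuncturedEllipticData

namespace TrivialModel

open Literature.AnabelianGeometry.AbsoluteAnabelian Topology

/-- The ambient group of the model: `Π_C = ℤ/10`, multiplicatively, with the discrete topology.
[claim: Mochizuki2012, status: disputed] -/
abbrev Amb : Type := Multiplicative (ZMod 10)

/-- The Galois group of the model: trivial (`ℤ/1`). [claim: Mochizuki2012, status: disputed] -/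
abbrev Gal : Type := Multiplicative (ZMod 1)

/-- Reduction mod `2` on `ℤ/10` (multiplicatively): its kernel is `Π_X = 2ℤ/10`.
[claim: Mochizuki2012, status: disputed] -/
def mod2 : Amb →* Multiplicative (ZMod 2) :=
  AddMonoidHom.toMultiplicative (ZMod.castHom (show 2 ∣ 10 by norm_num) (ZMod 2)).toAddMonoidHom

/-- Reduction mod `5` on `ℤ/10` (multiplicatively): its kernel is `5ℤ/10`, which will be `Π_{C→}`.
[claim: Mochizuki2012, status: disputed] -/
def mod5 : Amb →* Multiplicative (ZMod 5) :=
  AddMonoidHom.toMultiplicative (ZMod.castHom (show 5 ∣ 10 by norm_num) (ZMod 5)).toAddMonoidHom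

/-- `Π_X = 2ℤ/10`. [claim: Mochizuki2012, status: disputed] -/
def PiXm : Subgroup Amb := mod2.ker

/-- `5ℤ/10` (the `5`-th powers of `ℤ/10`). [claim: Mochizuki2012, status: disputed] -/
def Tm : Subgroup Amb := mod5.ker

/-- Membership in `2ℤ/10` is decidable. [folklore] -/
instance : DecidablePred (· ∈ PiXm) := fun x =>
  inferInstanceAs (Decidable (mod2 x = 1))

/-- Membership in `5ℤ/10` is decidable. [folklore] -/
instance : DecidablePred (· ∈ Tm) := fun x =>
  inferInstanceAs (Decidable (mod5 x = 1))

/-- Membership in `Π_X = 2ℤ/10`. ([IUTchI] §1 p.37) [claim: Mochizuki2012, status: disputed] -/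
theorem mem_piXm_iff (x : Amb) : x ∈ PiXm ↔ mod2 x = 1 := Iff.rfl

/-- Membership in `5ℤ/10`. ([IUTchI] §1 p.37) [claim: Mochizuki2012, status: disputed] -/
theorem mem_tm_iff (x : Amb) : x ∈ Tm ↔ mod5 x = 1 := Iff.rfl

/-- `Π_X` is normal (a kernel). [folklore] -/
instance piXm_normal : PiXm.Normal := inferInstanceAs mod2.ker.Normal

/-- `5ℤ/10` is normal (a kernel). [folklore] -/
instance tm_normal : Tm.Normal := inferInstanceAs mod5.ker.Normal

/-- The elements of `5ℤ/10` are their own `5`-th powers (`5·5 ≡ 5`, `5·0 ≡ 0 (mod 10)`).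
[claim: Mochizuki2012, status: disputed] -/
theorem pow_five_eq_self_of_mem_tm : ∀ x : Amb, x ∈ Tm → x ^ 5 = x := by
  decide

/-- The augmentation of the model: the trivial homomorphism `ℤ/10 → 1`. [claim: Mochizuki2012, status: disputed] -/
def augm : Amb →ₜ* Gal where
  toMonoidHom := 1
  continuous_toFun := continuous_of_discreteTopology

/-- The fundamental extension of the model: `Π_C = ℤ/10 ↠ G_k = 1` (reducible, so that the carrier
computes to `Amb`). [claim: Mochizuki2012, status: disputed] -/
abbrev toyExt : FundamentalExtension.{0} :=
  ⟨ProfiniteGrp.of Amb, ProfiniteGrp.of Gal, augm, fun _ => ⟨1, Subsingleton.elim _ _⟩⟩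

/-- In the model `Δ_C = Π_C` (the Galois group is trivial). [claim: Mochizuki2012, status: disputed] -/
theorem geom_eq_top : toyExt.geom = ⊤ := by
  ext x
  simp only [Subgroup.mem_top, iff_true]
  exact Subsingleton.elim _ _

/-- The four cusps of the model. [claim: Mochizuki2012, status: disputed] -/
inductive Cusp : Type
  | e0 | e1 | e2 | e22
  deriving DecidableEq

/-- Decomposition groups of the model's cusps: `1, Π_X̲, Π_X̲, 1`. [claim: Mochizuki2012, status: disputed] -/
def decomp : Cusp → Subgroup Amb
  | .e0 => ⊥
  | .e1 => PiXm
  | .e2 => PiXm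
  | .e22 => ⊥

/-- `[ℤ/10 : 2ℤ/10] = 2`. [claim: Mochizuki2012, status: disputed] -/
theorem index_piXm : PiXm.index = 2 := by
  rw [Subgroup.index_eq_two_iff]
  refine ⟨Multiplicative.ofAdd 1, fun b => ?_⟩
  simp only [mem_piXm_iff]
  revert b
  decide

/-- `[ℤ/10 : 5ℤ/10] = 5`. [claim: Mochizuki2012, status: disputed] -/
theorem index_tm : Tm.index = 5 := by
  have hsurj : Function.Surjective mod5 := by
    intro y
    refine ⟨Multiplicative.ofAdd (y.toAdd.cast : ZMod 10), ?_⟩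
    revert y
    decide
  rw [Tm, Subgroup.index_ker, MonoidHom.range_eq_top.mpr hsurj, Subgroup.card_top,
    Nat.card_eq_fintype_card]
  rfl

/-- `|ℤ/10| = 10`. [claim: Mochizuki2012, status: disputed] -/
theorem card_amb : Nat.card Amb = 10 := by
  rw [Nat.card_eq_fintype_card]; rfl

/-- `|2ℤ/10| = 5`. [claim: Mochizuki2012, status: disputed] -/
theorem card_piXm : Nat.card PiXm = 5 := by
  have h := PiXm.card_mul_index
  rw [index_piXm, card_amb] at h
  omega

/-- `2ℤ/10 ∩ 5ℤ/10 = 0`. [claim: Mochizuki2012, status: disputed] -/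
theorem piXm_inf_tm : PiXm ⊓ Tm = ⊥ := by
  ext x
  simp only [Subgroup.mem_inf, mem_piXm_iff, mem_tm_iff, Subgroup.mem_bot]
  revert x
  decide

/-- **The model datum.** `l = 5`; `Π_C = ℤ/10 ↠ 1`; `Π_X = 2ℤ/10`, `Π_C̲ = Π_C`; cusps `ε⁰, ε′, ε″, 2ε`
with decomposition groups `1, Π_X̲, Π_X̲, 1`.  (∗) holds because the group is abelian.
([IUTchI] §1 p.37) [claim: Mochizuki2012, status: disputed] -/
abbrev toyDatum : PuncturedEllipticData.{0} where
  l := 5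
  five_le := le_rfl
  coprime_six := by decide
  E := toyExt
  PiX := PiXm
  PiCbar := ⊤
  isOpen_piX := isOpen_discrete _
  isOpen_piCbar := isOpen_discrete _
  index_piX := index_piXm
  aug_piX := fun _ => ⟨1, Subsingleton.elim _ _⟩
  aug_piCbar := fun _ => ⟨1, Subsingleton.elim _ _⟩
  star := by
    intro g _ x _
    have h : g * x * g⁻¹ * x⁻¹ = 1 := by
      rw [mul_comm g x, mul_inv_cancel_right, mul_inv_cancel]
    rw [h]
    exact Subgroup.one_mem _
  Cusp := Cusp
  decomp := decomp
  decomp_le := by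
    intro x
    cases x
    · exact bot_le
    · exact le_inf le_rfl le_top
    · exact le_inf le_rfl le_top
    · exact bot_le
  ε0 := .e0
  ε1 := .e1
  ε2 := .e2
  twoε := .e22
  ε1_ne_ε0 := by decide
  ε2_ne_ε0 := by decide
  ε1_ne_ε2 := by decide
  twoε_ne := by decide
  aug_decomp_twoε := fun _ => ⟨1, Subsingleton.elim _ _⟩

/-! ### The construction of pp. 37–38 in the model: everything collapses -/
/-- `Π_C` of the model is `ℤ/10`. ([IUTchI] §1 p.37) [claim: Mochizuki2012, status: disputed] -/
theorem piC_eq : toyDatum.PiC = Amb := rfl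

/-- `Δ_C = Π_C` in the model. ([IUTchI] §1 p.37) [claim: Mochizuki2012, status: disputed] -/
theorem deltaC_eq_top : toyDatum.DeltaC = ⊤ := geom_eq_top

/-- `Π_X̲ = Π_X` in the model. ([IUTchI] §1 p.37) [claim: Mochizuki2012, status: disputed] -/
theorem piXbar_eq : toyDatum.PiXbar = PiXm := by
  show PiXm ⊓ ⊤ = PiXm; exact inf_top_eq _

/-- `Δ_X̲ = Π_X` in the model. ([IUTchI] §1 p.37) [claim: Mochizuki2012, status: disputed] -/
theorem deltaXbar_eq : toyDatum.DeltaXbar = PiXm := by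
  show toyDatum.PiXbar ⊓ toyDatum.DeltaC = PiXm; rw [piXbar_eq, deltaC_eq_top, inf_top_eq]

/-- `Δ_C̲ = Π_C` in the model. ([IUTchI] §1 p.37) [claim: Mochizuki2012, status: disputed] -/
theorem deltaCbar_eq : toyDatum.DeltaCbar = ⊤ := by
  show (⊤ : Subgroup Amb) ⊓ toyDatum.DeltaC = ⊤; rw [deltaC_eq_top, inf_top_eq]

/-- Elements of `Π_X̲ ≅ ℤ/5` have trivial `5`-th powers. [claim: Mochizuki2012, status: disputed] -/
theorem pow_five_eq_one {y : Amb} (hy : y ∈ PiXm) : y ^ 5 = 1 := by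
  revert hy y
  simp only [mem_piXm_iff]
  decide

/-- In a discrete group the topological closure of the trivial subgroup is trivial.
[claim: Mochizuki2012, status: disputed] -/
theorem topologicalClosure_bot : (⊥ : Subgroup Amb).topologicalClosure = ⊥ :=
  le_antisymm (Subgroup.topologicalClosure_minimal ⊥ le_rfl (isClosed_discrete _)) bot_le

/-- `Ker(Δ_X̲ ↠ Δ_X̲^{ab} ⊗ ℤ/5) = 1` in the model (`Δ_X̲ ≅ ℤ/5` is abelian of exponent `5`). ([IUTchI] §1 p.37) [claim: Mochizuki2012, status: disputed] -/
theorem modLKer_eq_bot : toyDatum.modLKer = ⊥ := by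
  show (⁅toyDatum.DeltaXbar, toyDatum.DeltaXbar⁆ ⊔ Subgroup.closure
    ((fun y : Amb => y ^ 5) '' (toyDatum.DeltaXbar : Set Amb))).topologicalClosure = ⊥
  rw [deltaXbar_eq]
  have h1 : ⁅PiXm, PiXm⁆ = ⊥ := by
    rw [eq_bot_iff, Subgroup.commutator_le]
    intro a _ b _
    rw [Subgroup.mem_bot, commutatorElement_def, mul_comm a b, mul_inv_cancel_right, mul_inv_cancel]
  have h2 : Subgroup.closure ((fun y : Amb => y ^ 5) '' (PiXm : Set Amb)) = ⊥ := by
    rw [eq_bot_iff, Subgroup.closure_le]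
    rintro _ ⟨y, hy, rfl⟩
    exact pow_five_eq_one hy
  rw [h1, h2, bot_sup_eq]
  exact topologicalClosure_bot

/-- Inertia groups equal decomposition groups in the model (`G_k = 1`). ([IUTchI] §1 p.37) [claim: Mochizuki2012, status: disputed] -/
theorem inertia_eq (x : toyDatum.Cusp) : toyDatum.inertia x = decomp x := by
  show decomp x ⊓ toyDatum.DeltaC = decomp x; rw [deltaC_eq_top, inf_top_eq]

/-- `Ker(Δ_X̲ ↠ Δ_ε) = 1` in the model (the only extra cusp `2ε` has trivial inertia). ([IUTchI] §1 p.37) [claim: Mochizuki2012, status: disputed] -/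
theorem deltaEpsKer_eq_bot : toyDatum.deltaEpsKer = ⊥ := by
  show toyDatum.modLKer ⊔ ⨆ x : {x : Cusp // toyDatum.IsNonzeroCusp x ∧ x ≠ Cusp.e1 ∧ x ≠ Cusp.e2},
    toyDatum.inertia x.1 = ⊥
  rw [modLKer_eq_bot, bot_sup_eq, eq_bot_iff]
  refine iSup_le fun x => ?_
  obtain ⟨x, hx0, hx1, hx2⟩ := x
  rw [inertia_eq]
  cases x <;> first | exact absurd rfl hx0 | exact absurd rfl hx1 | exact absurd rfl hx2 | exact le_rfl

/-- `Ker(Δ_X̲ ↠ Δ_ε⁺) = 1` in the model (abelian: no commutators). ([IUTchI] §1 p.38) [claim: Mochizuki2012, status: disputed] -/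
theorem jKer_eq_bot : toyDatum.jKer = ⊥ := by
  show toyDatum.deltaEpsKer ⊔ Subgroup.closure {z : Amb | ∃ x ∈ toyDatum.DeltaXbar,
    ∃ c ∈ toyDatum.DeltaCbar, c ∉ toyDatum.DeltaXbar ∧ z = x * c * x⁻¹ * c⁻¹} = ⊥
  rw [deltaEpsKer_eq_bot, bot_sup_eq, eq_bot_iff, Subgroup.closure_le]
  rintro _ ⟨x, -, c, -, -, rfl⟩
  rw [SetLike.mem_coe, Subgroup.mem_bot, mul_comm x c, mul_inv_cancel_right, mul_inv_cancel]

/-- `Π_{X→} = 1` in the model. ([IUTchI] §1 p.38) [claim: Mochizuki2012, status: disputed] -/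
theorem piXarrow_eq_bot : toyDatum.piXarrow = ⊥ := by
  show decomp Cusp.e22 ⊔ toyDatum.jKer = ⊥
  rw [jKer_eq_bot, show decomp Cusp.e22 = ⊥ from rfl, bot_sup_eq]

/-- The inverse image of `Gal(X̲/C̲)` is `5ℤ/10` in the model (the `5`-th powers of `ℤ/10`). ([IUTchI] §1 p.38) [claim: Mochizuki2012, status: disputed] -/
theorem galKer_eq : toyDatum.galKer = Tm := by
  show toyDatum.jKer ⊔ Subgroup.closure ((fun y : Amb => y ^ 5) '' (toyDatum.DeltaCbar : Set Amb)) = Tm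
  rw [jKer_eq_bot, bot_sup_eq, deltaCbar_eq]
  apply le_antisymm
  · rw [Subgroup.closure_le]
    rintro _ ⟨y, -, rfl⟩
    rw [SetLike.mem_coe, mem_tm_iff, map_pow]
    revert y
    decide
  · intro x hx
    exact Subgroup.subset_closure ⟨x, Subgroup.mem_top x, pow_five_eq_self_of_mem_tm x hx⟩

/-- `Π_{C→} = 5ℤ/10` in the model. ([IUTchI] §1 p.38) [claim: Mochizuki2012, status: disputed] -/
theorem piCarrow_eq : toyDatum.piCarrow = Tm := by
  show decomp Cusp.e22 ⊔ toyDatum.galKer = Tm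
  rw [galKer_eq, show decomp Cusp.e22 = ⊥ from rfl, bot_sup_eq]

/-! ### The printed claims hold in the model -/
/-- `ArrowCoveringClaims` holds for the model datum. ([IUTchI] §1 p.38) [claim: Mochizuki2012, status: disputed] -/
theorem arrowCoveringClaims : toyDatum.ArrowCoveringClaims where
  jKer_normal := by rw [jKer_eq_bot]; infer_instance
  jKer_relindex := by
    rw [jKer_eq_bot, deltaXbar_eq, Subgroup.relIndex_bot_left, card_piXm]
  inertia_ε1_sup := by
    rw [jKer_eq_bot, sup_bot_eq, inertia_eq, deltaXbar_eq]; rfl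
  inertia_ε2_sup := by
    rw [jKer_eq_bot, sup_bot_eq, inertia_eq, deltaXbar_eq]; rfl
  piXarrow_inf_delta := by rw [piXarrow_eq_bot, jKer_eq_bot, bot_inf_eq]
  aug_piXarrow := fun _ => ⟨1, Subsingleton.elim _ _⟩
  cartesian := by
    rw [piXarrow_eq_bot, piXbar_eq, piCarrow_eq, piXm_inf_tm]
  piXarrow_normal := by rw [piXarrow_eq_bot]; infer_instance
  piCarrow_normal := by rw [piCarrow_eq]; infer_instance
  piXarrow_relindex := by
    rw [piXarrow_eq_bot, Subgroup.relIndex_bot_left]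
    show Nat.card (⊤ : Subgroup Amb) = 2 * 5
    rw [Subgroup.card_top, card_amb]
  piCarrow_relindex := by
    rw [piCarrow_eq]
    show Tm.relIndex ⊤ = 5
    rw [Subgroup.relIndex_top_right, index_tm]
  galX_cyclic := by
    intro
    exact isCyclic_of_surjective _ (QuotientGroup.mk'_surjective _)
  galC_cyclic := by
    intro
    exact isCyclic_of_surjective _ (QuotientGroup.mk'_surjective _)

/-- `Rmk121` holds for the model datum (normalisers in an abelian group are everything).
([IUTchI] Rmk 1.2.1 p.40) [claim: Mochizuki2012, status: disputed] -/
theorem rmk121 : toyDatum.Rmk121 where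
  normalizer_piXarrow := by
    rw [piXarrow_eq_bot]
    show Subgroup.normalizer ((⊥ : Subgroup Amb) : Set Amb) = ⊤
    exact Subgroup.normalizer_eq_top (H := ⊥)
  normalizer_piCarrow := by
    rw [piCarrow_eq]
    show Subgroup.normalizer (Tm : Set Amb) = ⊤
    exact Subgroup.normalizer_eq_top (H := Tm)
  card_galX := arrowCoveringClaims.piXarrow_relindex
  card_galC := arrowCoveringClaims.piCarrow_relindex

/-! ### Even the typed Corollary 1.2 holds in the model (through the companion's assembly theorem) -/
/-- `|5ℤ/10| = 2`. [claim: Mochizuki2012, status: disputed] -/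
theorem card_tm : Nat.card Tm = 2 := by
  have h := Tm.card_mul_index
  rw [index_tm, card_amb] at h
  omega

/-- `|Π_{C→}| = 2` in the model. [claim: Mochizuki2012, status: disputed] -/
theorem card_piCarrow : Nat.card toyDatum.piCarrow = 2 := by
  rw [piCarrow_eq]; exact card_tm

/-- In a group with two elements, two non-identity elements coincide. [claim: Mochizuki2012, status: disputed] -/
private theorem eq_of_ne_one_of_card_eq_two {H : Type*} [Group H] (hH : Nat.card H = 2) {a b : H}
    (ha : a ≠ 1) (hb : b ≠ 1) : a = b := by
  obtain ⟨x, y, hxy, hxyu⟩ := Nat.card_eq_two_iff.mp hH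
  have hmem : ∀ z : H, z = x ∨ z = y := fun z => by
    have hz : z ∈ ({x, y} : Set H) := by rw [hxyu]; exact Set.mem_univ z
    simpa using hz
  rcases hmem 1 with h1 | h1
  · rcases hmem a with ha' | ha'
    · exact absurd (ha'.trans h1.symm) ha
    rcases hmem b with hb' | hb'
    · exact absurd (hb'.trans h1.symm) hb
    rw [ha', hb']
  · rcases hmem a with ha' | ha'
    swap
    · exact absurd (ha'.trans h1.symm) ha
    rcases hmem b with hb' | hb'
    swap
    · exact absurd (hb'.trans h1.symm) hb
    rw [ha', hb']

/-- Every automorphism of the order-`2` group `Π_{C→}` of the model is the identity on elements.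
[claim: Mochizuki2012, status: disputed] -/
theorem mulEquiv_piCarrow_apply (ψ : toyDatum.piCarrow ≃* toyDatum.piCarrow) (y : toyDatum.piCarrow) :
    ψ y = y := by
  by_cases hy : y = 1
  · rw [hy, map_one]
  · exact eq_of_ne_one_of_card_eq_two card_piCarrow
      (fun h => hy (ψ.injective (h.trans (map_one ψ).symm))) hy

/-- The identity of `Π_C̲` maps every set of subgroups to itself. [claim: Mochizuki2012, status: disputed] -/
theorem image_map_refl (S : Set (Subgroup toyDatum.PiCbar)) :
    Subgroup.map (MulEquiv.refl toyDatum.PiCbar).toMonoidHom '' S = S := by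
  have hid : ∀ K : Subgroup toyDatum.PiCbar, Subgroup.map (MulEquiv.refl _).toMonoidHom K = K :=
    fun K => by ext; simp
  have : Subgroup.map (MulEquiv.refl toyDatum.PiCbar).toMonoidHom = id := funext hid
  rw [this, Set.image_id]

/-- **The typed Corollary 1.2 holds for the model pair `(toyDatum, toyDatum)`** — obtained THROUGH the
companion's `characteristicNatureOfCoverings_of_core_extensions` with the identity of `Π_C̲` as the
extension (in the model `Π_{X→} = 1` and `Aut(Π_{C→}) = Aut(ℤ/2) = 1`), witnessing that the predicate
`CharacteristicNatureOfCoverings` is satisfiable as typed and that the assembly theorem applies to an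
actual datum. ([IUTchI] Cor 1.2 p.39) [claim: Mochizuki2012, status: disputed] -/
theorem characteristicNatureOfCoverings : toyDatum.CharacteristicNatureOfCoverings toyDatum := by
  refine characteristicNatureOfCoverings_of_core_extensions arrowCoveringClaims arrowCoveringClaims
    (fun φ _ _ => ⟨MulEquiv.refl _, continuous_id, fun x hx hx' => ?_, image_map_refl _,
      image_map_refl _⟩)
    (fun ψ _ _ => ⟨MulEquiv.refl _, continuous_id, fun x hx hx' => ?_, image_map_refl _⟩)
  · have hx1 : x = 1 := by
      have h := hx
      rw [piXarrow_eq_bot] at h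
      exact h
    subst hx1
    rw [show (⟨1, hx⟩ : toyDatum.piXarrow) = 1 from rfl, map_one]
    rfl
  · rw [mulEquiv_piCarrow_apply ψ ⟨x, hx⟩]
    rfl

end TrivialModel

end PuncturedEllipticData

end Literature.IUT.HodgeTheaters
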